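import Literature.NumberTheory.Transcendental.RoySmallValueFactors
import Mathlib.RingTheory.Polynomial.UniqueFactorization
import Mathlib.Algebra.MvPolynomial.Nilpotent
import Mathlib.RingTheory.Localization.Integer
import Mathlib.RingTheory.Localization.FractionRing
import Mathlib.RingTheory.MvPolynomial.Homogeneous
import Mathlib.Algebra.BigOperators.Fin
import HarnessLib

/-!
# EL♮(3) / EL♮(n), RUNG LC «large characteristic» — (i′) THE FACTOR MODELS: clearing denominators of the prime factorisation of the generic equation
# over `Frac A`, and the fibrewise reading `V(F_θ) = ⋃ᵢ V(Pᵢ,θ)` away from one non-zero element of `A`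

leafhand-res-equisingularlift-4 g0 (prover, 2026-08-31; one-generation line-first hand on stmt-ResolutionOfSingularities-20148 / -20038 / -15660, cell
`pub/decomp-res`).  Crux `EquisingularLiftNatThree` (`stmt-…-20148`; the rung is uniform in `n`, so also `stmt-…-20038`), line W4.5(b), RUNG LC (idea-2 g32
`Cruxes/EquisingularLiftNatThree/LARGE-CHAR-RUNG-idea2.md` v1.6; lh3's HONEST RESIDUAL (i) of `hspread`: «UFD factorisation in `K[x]`, clear denominators»).
The composition of `hspread` (✓ `LargeChar.elnatLargeChar_of_spread`) runs the spread door ONCE PER PRIME FACTOR of the generic equation `F_K` of the universal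
degree-`d` hypersurface over `A = ℤ[c]/𝔮` (`K = Frac A`, characteristic `0`); at a point `θ : A → k` the integral `H = V₊(F_θ)` is then ONE of the `V₊(Pᵢ,θ)`.
This file is the pure commutative algebra of that step, DEF-FREE:

* `exists_C_mul_eq_map` — clearing denominators: every `Q ∈ S[x]`, `S` a localisation of `A` at `M`, has `b ∈ M` and `P ∈ A[x]` with `P ↦ C(b) · Q`
  (Mathlib `IsLocalization.exist_integer_multiples_of_finset` on the coefficients);
* `isHomogeneous_of_map_injective` — homogeneity descends along an injective coefficient map;
* ★ `exists_factorModel` — `A` a domain with fraction field `K`, `F ∈ A[x]` homogeneous with `F_K ≠ 0`: there are finitely many HOMOGENEOUS `Pᵢ ∈ A[x]`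
  whose images in `K[x]` are PRIME, and `c ≠ 0` in `A`, such that for every ring map `θ : A → k` with `θ c` a unit and every prime ideal `𝔭` of `k[x]`:
  `F_θ ∈ 𝔭 ↔ ∃ i, Pᵢ,θ ∈ 𝔭` (from the identity `C(β ∏ bᵢ) · F = C(α) · ∏ Pᵢ` in `A[x]`, Mathlib's UFD `K[x]` (`UniqueFactorizationMonoid.exists_prime_factors`),
  units of `K[x]` are constants (`MvPolynomial.isUnit_iff_eq_C_of_isReduced`), factors of forms are forms (✓ `Roy2013.isHomogeneous_of_dvd`)).

EL♮(3) NOT proved; EL♮ NOT proved; resolution of singularities in positive characteristic NOT proved; nothing of [Hironaka2017] (a candidate under adjudication)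
is asserted or used.  [OURS · commutative-algebra bookkeeping · standard axioms · DEF-FREE · `--supports stmt-ResolutionOfSingularities-20148 --as helper`, counted 0 ·
AI-written, weaker than expert review.] [folklore]
-/

set_option linter.dupNamespace false -- mandated namespace `Summit.<Summit>.<Problem>` of this single-conjunct summit

noncomputable section

open MvPolynomial

namespace Summit.ResolutionOfSingularities.ResolutionOfSingularities.Cruxes.EquisingularLiftNat.Sections.LargeChar

section ClearDenominators

variable {σ : Type} {A : Type} [CommRing A] {S : Type} [CommRing S] [Algebra A S] (M : Submonoid A) [IsLocalization M S]

/-- **Clearing denominators** of a polynomial over a localisation: `Q ∈ S[x]` has `b ∈ M` and `P ∈ A[x]` with `map P = C(b) · Q`. [folklore] -/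
theorem exists_C_mul_eq_map (Q : MvPolynomial σ S) :
    ∃ (b : M) (P : MvPolynomial σ A), MvPolynomial.map (algebraMap A S) P = C (algebraMap A S b) * Q := by
  classical
  obtain ⟨b, hb⟩ := IsLocalization.exist_integer_multiples_of_finset M (Q.support.image fun m => Q.coeff m)
  have hb' : ∀ m ∈ Q.support, ∃ y : A, algebraMap A S y = (b : A) • Q.coeff m := fun m hm => by
    obtain ⟨y, hy⟩ := hb (Q.coeff m) (Finset.mem_image_of_mem _ hm)
    exact ⟨y, hy⟩
  choose! g hg using hb'
  refine ⟨b, ∑ m ∈ Q.support, monomial m (g m), ?_⟩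
  ext m
  rw [coeff_map, coeff_C_mul, coeff_sum]
  simp only [coeff_monomial, Finset.sum_ite_eq']
  by_cases hm : m ∈ Q.support
  · rw [if_pos hm, hg m hm, Algebra.smul_def]
  · rw [if_neg hm, map_zero, MvPolynomial.notMem_support_iff.mp hm, mul_zero]

end ClearDenominators

section Homogeneous

variable {σ : Type} {A S : Type} [CommRing A] [CommRing S]

/-- Homogeneity descends along an injective coefficient map. [folklore] -/
theorem isHomogeneous_of_map_injective {f : A →+* S} (hf : Function.Injective f) {P : MvPolynomial σ A} {e : ℕ}
    (h : (MvPolynomial.map f P).IsHomogeneous e) : P.IsHomogeneous e := by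
  intro m hm
  apply h
  rw [coeff_map]
  intro h0
  apply hm
  apply hf
  rw [h0, map_zero]

end Homogeneous

section FactorModel

variable (A K : Type) [CommRing A] [IsDomain A] [Field K] [Algebra A K] [IsFractionRing A K] {σ : Type}

/-- ★ **The factor models.**  `A` a domain with fraction field `K`, `F ∈ A[x]` homogeneous of degree `d` with non-zero image `F_K ∈ K[x]`.  There are
`N`, homogeneous `P₀, …, P_{N-1} ∈ A[x]` (of some degrees `eᵢ`) whose images in `K[x]` are PRIME, and `c ≠ 0` in `A`, such that for every ring map
`θ : A → k` (any commutative ring `k`) with `θ c` a unit and every prime ideal `𝔭 ⊆ k[x]`: `θ_* F ∈ 𝔭 ↔ ∃ i, θ_* Pᵢ ∈ 𝔭`.  (Prime factorisation of `F_K` in the UFD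
`K[x]`, denominators cleared factor by factor, the resulting identity `C(β·∏bᵢ)·F = C(α)·∏ Pᵢ` in `A[x]` read through `θ`.) [folklore] [OURS · L1 W4.5b · RUNG LC (i′)] -/
theorem exists_factorModel {d : ℕ} (F : MvPolynomial σ A) (hF : F.IsHomogeneous d) (hF0 : MvPolynomial.map (algebraMap A K) F ≠ 0) :
    ∃ (N : ℕ) (P : Fin N → MvPolynomial σ A) (e : Fin N → ℕ) (c : A), c ≠ 0 ∧
      (∀ i, (P i).IsHomogeneous (e i)) ∧ (∀ i, Prime (MvPolynomial.map (algebraMap A K) (P i))) ∧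
      ∀ (k : Type) [CommRing k] (θ : A →+* k), IsUnit (θ c) →
        ∀ 𝔭 : Ideal (MvPolynomial σ k), 𝔭.IsPrime → (MvPolynomial.map θ F ∈ 𝔭 ↔ ∃ i, MvPolynomial.map θ (P i) ∈ 𝔭) := by
  classical
  have hinj : Function.Injective (algebraMap A K) := IsFractionRing.injective A K
  set FK := MvPolynomial.map (algebraMap A K) F with hFK
  have hFKhom : FK.IsHomogeneous d := hF.map _
  -- prime factorisation of `F_K` in the UFD `K[x]`, the unit being a constant
  obtain ⟨f, hfprime, u, hu⟩ := UniqueFactorizationMonoid.exists_prime_factors FK hF0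
  obtain ⟨c₀, hc₀, hc₀u⟩ := (MvPolynomial.isUnit_iff_eq_C_of_isReduced (P := (u : MvPolynomial σ K))).mp u.isUnit
  -- index the factors by `Fin N`
  set L := f.toList with hL
  set N := L.length with hN
  let Q : Fin N → MvPolynomial σ K := fun i => L[i.1]
  have hQmem : ∀ i, Q i ∈ f := fun i => by
    rw [← Multiset.mem_toList]
    exact List.getElem_mem i.2
  have hQprod : ∏ i, Q i = f.prod := by
    rw [← Multiset.prod_toList]
    exact Fin.prod_univ_getElem L
  have hFK_eq : FK = C c₀ * ∏ i, Q i := by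
    rw [hQprod, ← hu, hc₀u, mul_comm]
  -- each factor is a form dividing `F_K`
  have hQhom : ∀ i, (Q i).IsHomogeneous (Q i).totalDegree := fun i => by
    refine Literature.NumberTheory.Transcendental.Roy2013.isHomogeneous_of_dvd hFKhom hF0 ?_
    rw [hFK_eq]
    exact Dvd.dvd.mul_left (Finset.dvd_prod_of_mem _ (Finset.mem_univ i)) _
  -- clear denominators factor by factor
  have hclear : ∀ i, ∃ (b : nonZeroDivisors A) (P : MvPolynomial σ A),
      MvPolynomial.map (algebraMap A K) P = C (algebraMap A K b) * Q i := fun i =>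
    exists_C_mul_eq_map (nonZeroDivisors A) (Q i)
  choose b P hbP using hclear
  -- the unit constant as a fraction `c₀ = α / β`
  obtain ⟨α, β, hαβ⟩ := IsLocalization.exists_mk'_eq (M := nonZeroDivisors A) (S := K) c₀
  have hαβ' : algebraMap A K α = c₀ * algebraMap A K β := by
    rw [← hαβ, IsLocalization.mk'_spec]
  have hβ0 : (β : A) ≠ 0 := nonZeroDivisors.coe_ne_zero β
  have hα0 : α ≠ 0 := by
    intro h
    rw [h, map_zero, eq_comm, mul_eq_zero] at hαβ'
    rcases hαβ' with h1 | h1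
    · exact hc₀.ne_zero h1
    · exact hβ0 (hinj (by rw [h1, map_zero]))
  have hb0 : ∀ i, ((b i : A)) ≠ 0 := fun i => nonZeroDivisors.coe_ne_zero (b i)
  -- the identity in `A[x]`
  have hident : C ((β : A) * ∏ i, (b i : A)) * F = C α * ∏ i, P i := by
    apply MvPolynomial.map_injective (algebraMap A K) hinj
    have hprodP : MvPolynomial.map (algebraMap A K) (∏ i, P i) = C (algebraMap A K (∏ i, (b i : A))) * ∏ i, Q i := by
      rw [map_prod (MvPolynomial.map (algebraMap A K)), map_prod (algebraMap A K), map_prod C, ← Finset.prod_mul_distrib]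
      exact Finset.prod_congr rfl fun i _ => hbP i
    rw [RingHom.map_mul (MvPolynomial.map (algebraMap A K)), RingHom.map_mul (MvPolynomial.map (algebraMap A K)),
      MvPolynomial.map_C, MvPolynomial.map_C, hprodP, ← hFK, hFK_eq, hαβ',
      RingHom.map_mul (algebraMap A K) (β : A), RingHom.map_mul C, RingHom.map_mul C]
    ring
  refine ⟨N, P, fun i => (Q i).totalDegree, α * β * ∏ i, (b i : A), ?_, ?_, ?_, ?_⟩
  · exact mul_ne_zero (mul_ne_zero hα0 hβ0) (Finset.prod_ne_zero_iff.mpr fun i _ => hb0 i)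
  · intro i
    refine isHomogeneous_of_map_injective hinj ?_
    rw [hbP]
    have h := (isHomogeneous_C σ (algebraMap A K (b i))).mul (hQhom i)
    rwa [zero_add] at h
  · intro i
    rw [hbP]
    refine (associated_unit_mul_left (Q i) (C (algebraMap A K (b i))) ?_).symm.prime (hfprime _ (hQmem i))
    exact (isUnit_iff_ne_zero.mpr ((map_ne_zero_iff _ hinj).mpr (hb0 i))).map C
  · intro k _ θ hθc 𝔭 h𝔭
    rw [RingHom.map_mul θ, RingHom.map_mul θ, IsUnit.mul_iff, IsUnit.mul_iff] at hθc
    obtain ⟨⟨hθα, hθβ⟩, hθb⟩ := hθc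
    have hθ : C (θ ((β : A) * ∏ i, (b i : A))) * MvPolynomial.map θ F = C (θ α) * ∏ i, MvPolynomial.map θ (P i) := by
      rw [← MvPolynomial.map_C (f := θ) ((β : A) * ∏ i, (b i : A)), ← MvPolynomial.map_C (f := θ) α,
        ← map_prod (MvPolynomial.map θ), ← RingHom.map_mul (MvPolynomial.map θ), ← RingHom.map_mul (MvPolynomial.map θ), hident]
    have hu1 : IsUnit (C (σ := σ) (θ ((β : A) * ∏ i, (b i : A)))) := by
      rw [RingHom.map_mul θ]
      exact (hθβ.mul hθb).map C
    have hu2 : IsUnit (C (σ := σ) (θ α)) := hθα.map C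
    haveI := h𝔭
    constructor
    · intro hF𝔭
      have h1 : C (θ ((β : A) * ∏ i, (b i : A))) * MvPolynomial.map θ F ∈ 𝔭 := Ideal.mul_mem_left _ _ hF𝔭
      rw [hθ, Ideal.unit_mul_mem_iff_mem _ hu2, Ideal.IsPrime.prod_mem_iff] at h1
      obtain ⟨i, -, hi⟩ := h1
      exact ⟨i, hi⟩
    · rintro ⟨i, hi⟩
      have h1 : C (θ α) * ∏ i, MvPolynomial.map θ (P i) ∈ 𝔭 :=
        Ideal.mul_mem_left _ _ ((Ideal.IsPrime.prod_mem_iff).mpr ⟨i, Finset.mem_univ i, hi⟩)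
      rw [← hθ, Ideal.unit_mul_mem_iff_mem _ hu1] at h1
      exact h1

end FactorModel

end Summit.ResolutionOfSingularities.ResolutionOfSingularities.Cruxes.EquisingularLiftNat.Sections.LargeChar

end
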